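import Mathlib
import Literature.Computability.AlgebraicComplexity.RazUniversalCircuits
import Literature.Computability.AlgebraicComplexity.HomogeneousComponentsComplexity
import Summits.ValiantsHypothesis.ValiantsHypothesis.Theorems.BarrierLeverDefinableEquationsQuasiPolyLemmas
import Summits.ValiantsHypothesis.ValiantsHypothesis.Theorems.BarrierLeverDefinableEquationsDegreeWindow
import Summits.ValiantsHypothesis.ValiantsHypothesis.Theorems.BarrierLeverDefinableEquationsDegreeWindowThin
import HarnessLib

/-!
# Crux `BarrierLever.DefinableEquations` (stmt-8745) ⟺ `SingleSizeEquations` (stmt-8749) —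
# window equations of POLYNOMIAL DEGREE: in the degree-`d` window, `d = 10b + 11`, a nonzero
# polynomial of total degree `≤ poly(n)` vanishes on `coeff_d(SmallCircuits ℂ n b)` (val-np-p5 g22)

The degree-window files (`…DegreeWindow{,Thin,Sparsity,Door,Balanced}.lean`) show: a witness of the
crux at `b` may live in a FIXED-degree window (door), such windows are thin from `d = b + 1` on
(constant count — no degree bound), and every window witness for size `s` has `≥ 2^{(s-2n-1)/(d+1)+1}`
monomials, each touching `> s/(d+1)` coordinates (so total degree `> n^b/(d+1)`).  This file bounds
the degree FROM ABOVE in a (larger) constant-degree window: Raz's polynomial map `Γ` (tree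
`RazUniversal.uCoeff`, label-degree `≤ 2d - 1` — a CONSTANT for fixed `d` —
`RazUniversal.exists_eval_uCoeff_eq_coeff`, Prop. 3.3) parametrises the degree-`d` components of
`SmallCircuits ℂ n b` (complexity `≤ (d+2)² n^b` by BCS Lemma 21.25) by
`m ≤ 3 (n + d + 4 (d+2)² (d+1)² n^b + 1)^5 = O_d(n^{5b+5})` labels; the block dimension count of
lead c4 (`QuasiPoly.exists_annihilator`: `D = m + 1` blocks of `K = 2dD + 2` distinct window
coordinates, `(D(2d-1)+1)^m < K^D`) then yields a NONZERO window polynomial of total degree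
`≤ D = m + 1` and size `≤ K^D (D+2)` vanishing on the window — as soon as the window has `D·K`
distinct coordinates, which holds in degree `d = 10b + 11` eventually in `n`.

* §1 `exists_windowEquation_degree_le` — the parametric statement (any `n, b, d ≥ 1` with
  `(m+1)(2d(m+1)+2) ≤ C(n+d-1,d)`): a nonzero window equation for `SmallCircuits ℂ n b` of total
  degree `≤ m + 1` and complexity `≤ K^D (D + 2)`.
* §2 `windowCoords_eventually` — the coordinate supply at `d = 10b + 11`;
  `exists_lowDegree_windowEquation` — for every `b`, eventually in `n`, a nonzero polynomial in
  the degree-`(10b+11)` window variables of total degree `≤ 3 (c n^{b+1})^5 + 1`,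
  `c = 4(d+2)²(d+1)² + d + 2`, vanishing on `coeff_d(SmallCircuits ℂ n b)`: window witnesses of
  degree `poly(n) = polylog(N)` EXIST (non-explicitly); with §6 of `…DegreeWindowSparsity` the
  least degree of a window equation at `(b, d)` lies between `n^b/(d+1)` and `poly(n)`.

Honest framing: existence by dimension count; the window degree `10b + 11` (31 at `b = 2`) is an
artefact of Raz's label count `m = O(n^{5b+5})` (a Kumar–Volk / Shpilka–Volkovich relabelling of
a sum-preserving universal circuit would give `O(n^b)` parameters of polynomial degree and bring
this to `d = b + 2`; not in the tree).  8745/8749 stay OPEN at `b = 2` (Chatterjee–Tengse 2023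
§1.3 dir. 2); nothing on crux 14610 or `VP ≠ VNP`, which is NOT proved.  No definitions, no named
facts; standard axioms.  (Imports `…QuasiPolyLemmas`, which imports the route file: theses-cone
lint debt shared with lead c4's files.)

References: R. Raz, Theory Comput. 6 (2010), Prop. 3.3; Bürgisser–Clausen–Shokrollahi 1997,
Lemma (21.25), §9.1; J. Heintz, C.-P. Schnorr, STOC 1980; Kumar–Volk, ACM TOCT 14 (2022) §3
(low-degree universal maps); Chatterjee–Tengse arXiv:2309.07612 §1.2.
-/

set_option linter.dupNamespace false

noncomputable section

namespace Summit.ValiantsHypothesis.ValiantsHypothesis.Theorems.BarrierLeverDefinableEquations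

open MvPolynomial
open Literature.Computability.AlgebraicComplexity Literature.Barriers.ValiantsHypothesis
open scoped BigOperators

namespace DegreeWindow

open QuasiPoly

/-! ## §1 Window equations of degree `≤ (number of Raz labels) + 1` -/

/-- **Low-degree window equations (parametric).** Let `d ≥ 1`, `s = (d+2)² n^b`, `N = 4 s (d+1)²`,
`m = #Lab(n, d, N)` (Raz's labels), `D = m + 1`, `K = 2dD + 2`.  If the degree-`d` window has at
least `D·K` coordinates, then some NONZERO polynomial in the degree-`d` window variables, of total
degree `≤ D` and complexity `≤ K^D (D+2)`, vanishes at `coeff_d(f)` for every `f ∈ SmallCircuits ℂ n b`.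
[cite: Raz2010, Prop. 3.3; BurgisserClausenShokrollahi1997, §9.1] -/
theorem exists_windowEquation_degree_le {n b d : ℕ} (hd : 1 ≤ d)
    (hcoords : (Fintype.card (RazUniversal.Lab (Fin n) d (4 * ((d + 2) ^ 2 * n ^ b) * (d + 1) ^ 2)) + 1) *
        (2 * d * (Fintype.card (RazUniversal.Lab (Fin n) d (4 * ((d + 2) ^ 2 * n ^ b) * (d + 1) ^ 2)) + 1) + 2)
      ≤ (n + d - 1).choose d) :
    ∃ E : MvPolynomial (GKSS2017.homMonomials n d) ℂ, E ≠ 0 ∧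
      E.totalDegree ≤
        Fintype.card (RazUniversal.Lab (Fin n) d (4 * ((d + 2) ^ 2 * n ^ b) * (d + 1) ^ 2)) + 1 ∧
      complexity E ≤
        (2 * d * (Fintype.card (RazUniversal.Lab (Fin n) d (4 * ((d + 2) ^ 2 * n ^ b) * (d + 1) ^ 2)) + 1) + 2) ^
          (Fintype.card (RazUniversal.Lab (Fin n) d (4 * ((d + 2) ^ 2 * n ^ b) * (d + 1) ^ 2)) + 1) *
        (Fintype.card (RazUniversal.Lab (Fin n) d (4 * ((d + 2) ^ 2 * n ^ b) * (d + 1) ^ 2)) + 1 + 2) ∧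
      ∀ f ∈ SmallCircuits ℂ n b, eval (coeffVector (GKSS2017.homMonomials n d) f) E = 0 := by
  classical
  set s := (d + 2) ^ 2 * n ^ b with hs
  set N := 4 * s * (d + 1) ^ 2 with hN
  set m := Fintype.card (RazUniversal.Lab (Fin n) d N) with hm
  set D := m + 1 with hD
  set K := 2 * d * D + 2 with hKdef
  haveI := finite_homMonomials n d
  haveI : Fintype (GKSS2017.homMonomials n d) := Fintype.ofFinite _
  -- a supply of `D K` distinct window coordinates
  have hDK : D * K ≤ Fintype.card (GKSS2017.homMonomials n d) := by
    rw [← Nat.card_eq_fintype_card, natCard_homMonomials]; exact hcoords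
  let emb : Fin (D * K) ↪ GKSS2017.homMonomials n d :=
    (Fin.castLEEmb hDK).trans (Fintype.equivFin (GKSS2017.homMonomials n d)).symm.toEmbedding
  let t : Fin D × Fin K → GKSS2017.homMonomials n d := fun p => emb (finProdFinEquiv p)
  have ht : Function.Injective t :=
    fun p q hpq => finProdFinEquiv.injective (emb.injective hpq)
  -- Raz's coordinates as polynomials in the labels, of degree `≤ 2d - 1`
  let u : GKSS2017.homMonomials n d → MvPolynomial (RazUniversal.Lab (Fin n) d N) ℂ :=
    fun e => RazUniversal.uCoeff ℂ (Fin n) d N (e : Fin n →₀ ℕ)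
  have hu : ∀ e, (u e).totalDegree ≤ 2 * d - 1 := fun e => RazUniversal.totalDegree_uCoeff_le _
  -- the dimension count `(D(2d-1)+1)^m < K^D`
  have hcard : (D * (2 * d - 1) + 1) ^ Fintype.card (RazUniversal.Lab (Fin n) d N) < K ^ D := by
    rw [← hm]
    have h1 : D * (2 * d - 1) + 1 ≤ K - 1 := by
      have : D * (2 * d - 1) ≤ D * (2 * d) := Nat.mul_le_mul_left _ (Nat.sub_le _ _)
      have : D * (2 * d) = 2 * d * D := by ring
      omega
    calc (D * (2 * d - 1) + 1) ^ m ≤ (K - 1) ^ m := Nat.pow_le_pow_left h1 m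
      _ < K ^ m * K := by
          have hKm : (K - 1) ^ m ≤ K ^ m := Nat.pow_le_pow_left (Nat.sub_le _ _) m
          have hpos : 0 < K ^ m := pow_pos (by omega) m
          have h2 : 2 ≤ K := by omega
          nlinarith
      _ = K ^ D := by rw [hD, pow_succ]
  obtain ⟨c, hc0, hcomb⟩ := exists_annihilator u (2 * d - 1) hu D K t hcard
  refine ⟨∑ g, c g • ∏ j, X (t (j, g j)), blockPoly_ne_zero ht hc0, totalDegree_blockPoly_le t c,
    complexity_blockPoly_le t c, ?_⟩
  -- vanishing on the window of small circuits
  intro f hf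
  obtain ⟨hhom, hcx⟩ := homogeneousComponent_mem_forms (d := d) hf
  have hNle : 4 * ((d + 2) ^ 2 * n ^ b) * (d + 1) ^ 2 ≤ N := by rw [hN, hs]
  obtain ⟨y, hy⟩ := RazUniversal.exists_eval_uCoeff_eq_coeff (R := ℂ) (σ := Fin n) (r := d) (N := N)
    hd hNle hhom hcx
  have hfun : coeffVector (GKSS2017.homMonomials n d) f = fun e => eval y (u e) := by
    rw [coeffVector_homMonomials_eq_homogeneousComponent]
    funext e
    rw [coeffVector_apply, ← hy]
  rw [hfun, eval_blockPoly]
  have hcomb' := congrArg (MvPolynomial.eval y) hcomb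
  rw [eval_blockComb, map_zero] at hcomb'
  exact hcomb'

/-! ## §2 The coordinate supply at `d = 10b + 11` -/

/-- Raz's label count in the window: `m ≤ 3 (c n^{b+1})^5`, `c = 4(d+2)²(d+1)² + d + 2` (`n ≥ 1`).
[cite: Raz2010, §3.2] -/
theorem card_lab_window_le {n b d : ℕ} (hn : 1 ≤ n) :
    Fintype.card (RazUniversal.Lab (Fin n) d (4 * ((d + 2) ^ 2 * n ^ b) * (d + 1) ^ 2)) ≤
      3 * ((4 * (d + 2) ^ 2 * (d + 1) ^ 2 + d + 2) * n ^ (b + 1)) ^ 5 := by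
  have h1 := RazUniversal.card_lab_le (σ := Fin n) (r := d)
    (N := 4 * ((d + 2) ^ 2 * n ^ b) * (d + 1) ^ 2)
  rw [Fintype.card_fin] at h1
  refine h1.trans (Nat.mul_le_mul_left 3 (Nat.pow_le_pow_left ?_ 5))
  have hnb : n ^ b ≤ n ^ (b + 1) := Nat.pow_le_pow_right hn (Nat.le_succ b)
  have hn1 : n ≤ n ^ (b + 1) := by
    calc n = n ^ 1 := (pow_one n).symm
      _ ≤ n ^ (b + 1) := Nat.pow_le_pow_right hn (by omega)
  have hone : 1 ≤ n ^ (b + 1) := Nat.one_le_pow _ _ hn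
  have h2 : 4 * ((d + 2) ^ 2 * n ^ b) * (d + 1) ^ 2 ≤ 4 * (d + 2) ^ 2 * (d + 1) ^ 2 * n ^ (b + 1) := by
    calc 4 * ((d + 2) ^ 2 * n ^ b) * (d + 1) ^ 2 = 4 * (d + 2) ^ 2 * (d + 1) ^ 2 * n ^ b := by ring
      _ ≤ 4 * (d + 2) ^ 2 * (d + 1) ^ 2 * n ^ (b + 1) := Nat.mul_le_mul_left _ hnb
  calc n + d + 4 * ((d + 2) ^ 2 * n ^ b) * (d + 1) ^ 2 + 1
      ≤ n ^ (b + 1) + d * n ^ (b + 1) + 4 * (d + 2) ^ 2 * (d + 1) ^ 2 * n ^ (b + 1) + n ^ (b + 1) := by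
        gcongr
        · exact Nat.le_mul_of_pos_right d hone
    _ = (4 * (d + 2) ^ 2 * (d + 1) ^ 2 + d + 2) * n ^ (b + 1) := by ring

/-- **The coordinate supply at `d = 10b + 11`, eventually in `n`.** With
`c = 4(d+2)²(d+1)² + d + 2`, `M = 3 c^5 + 1`, for `n ≥ d! · M (2dM + 2) + 1` the degree-`d` window has
at least `(m+1)(2d(m+1)+2)` coordinates. [folklore] -/
theorem windowCoords_eventually (b : ℕ) {n : ℕ}
    (hn : (10 * b + 11).factorial *
        ((3 * (4 * (10 * b + 11 + 2) ^ 2 * (10 * b + 11 + 1) ^ 2 + (10 * b + 11) + 2) ^ 5 + 1) *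
          (2 * (10 * b + 11) *
            (3 * (4 * (10 * b + 11 + 2) ^ 2 * (10 * b + 11 + 1) ^ 2 + (10 * b + 11) + 2) ^ 5 + 1) + 2)) +
        1 ≤ n) :
    (Fintype.card (RazUniversal.Lab (Fin n) (10 * b + 11)
        (4 * ((10 * b + 11 + 2) ^ 2 * n ^ b) * (10 * b + 11 + 1) ^ 2)) + 1) *
      (2 * (10 * b + 11) *
        (Fintype.card (RazUniversal.Lab (Fin n) (10 * b + 11)
          (4 * ((10 * b + 11 + 2) ^ 2 * n ^ b) * (10 * b + 11 + 1) ^ 2)) + 1) + 2)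
      ≤ (n + (10 * b + 11) - 1).choose (10 * b + 11) := by
  set d := 10 * b + 11 with hd
  set c := 4 * (d + 2) ^ 2 * (d + 1) ^ 2 + d + 2 with hc
  set M := 3 * c ^ 5 + 1 with hM
  set m := Fintype.card (RazUniversal.Lab (Fin n) d (4 * ((d + 2) ^ 2 * n ^ b) * (d + 1) ^ 2)) with hm
  have hn1 : 1 ≤ n := le_trans (by omega) hn
  have hP : 1 ≤ n ^ (b + 1) := Nat.one_le_pow _ _ hn1
  -- `m + 1 ≤ M · n^{5b+5}`
  have hmle : m ≤ 3 * (c * n ^ (b + 1)) ^ 5 := by rw [hm, hc]; exact card_lab_window_le hn1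
  have hD : m + 1 ≤ M * n ^ (5 * b + 5) := by
    have h5 : 1 ≤ n ^ (5 * b + 5) := Nat.one_le_pow _ _ hn1
    calc m + 1 ≤ 3 * (c * n ^ (b + 1)) ^ 5 + 1 := by omega
      _ = 3 * c ^ 5 * n ^ (5 * b + 5) + 1 := by rw [mul_pow, ← pow_mul]; ring_nf
      _ ≤ 3 * c ^ 5 * n ^ (5 * b + 5) + n ^ (5 * b + 5) := by omega
      _ = M * n ^ (5 * b + 5) := by rw [hM]; ring
  -- `K ≤ (2dM + 2) n^{5b+5}`
  have hK : 2 * d * (m + 1) + 2 ≤ (2 * d * M + 2) * n ^ (5 * b + 5) := by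
    have h5 : 1 ≤ n ^ (5 * b + 5) := Nat.one_le_pow _ _ hn1
    have := Nat.mul_le_mul_left (2 * d) hD
    nlinarith
  -- product `≤ M (2dM+2) n^{10b+10}`, and `d! · that · n^{10b+10} < n^d = n^{10b+11} ≤ d! C(n+d-1,d)`
  have hprod : (m + 1) * (2 * d * (m + 1) + 2) ≤ M * (2 * d * M + 2) * n ^ (10 * b + 10) := by
    calc (m + 1) * (2 * d * (m + 1) + 2) ≤ (M * n ^ (5 * b + 5)) * ((2 * d * M + 2) * n ^ (5 * b + 5)) :=
          Nat.mul_le_mul hD hK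
      _ = M * (2 * d * M + 2) * n ^ (10 * b + 10) := by rw [← show (5 * b + 5) + (5 * b + 5) = 10 * b + 10 by ring, pow_add]; ring
  have hfac := pow_le_factorial_mul_choose n d
  have hlt : d.factorial * (M * (2 * d * M + 2) * n ^ (10 * b + 10)) < n ^ d := by
    have hdeg : d = (10 * b + 10) + 1 := by omega
    calc d.factorial * (M * (2 * d * M + 2) * n ^ (10 * b + 10))
        = (d.factorial * (M * (2 * d * M + 2))) * n ^ (10 * b + 10) := by ring
      _ < n * n ^ (10 * b + 10) :=
          Nat.mul_lt_mul_of_pos_right (Nat.lt_of_succ_le hn) (Nat.one_le_pow _ _ hn1)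
      _ = n ^ d := by rw [hdeg, pow_succ]; ring
  by_contra hcon
  push Not at hcon
  have h1 : d.factorial * (n + d - 1).choose d < d.factorial * ((m + 1) * (2 * d * (m + 1) + 2)) :=
    Nat.mul_lt_mul_of_pos_left hcon (Nat.factorial_pos d)
  have h2 : d.factorial * ((m + 1) * (2 * d * (m + 1) + 2)) ≤
      d.factorial * (M * (2 * d * M + 2) * n ^ (10 * b + 10)) := Nat.mul_le_mul_left _ hprod
  omega

/-- **Window witnesses of polynomial degree exist.** For every `b`, eventually in `n`, some NONZERO
polynomial in the degree-`(10b+11)` window variables, of total degree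
`≤ 3 (c n^{b+1})^5 + 1 = poly(n)` (`c = 4(d+2)²(d+1)² + d + 2`, `d = 10b + 11`), vanishes at
`coeff_d(f)` for every `f ∈ SmallCircuits ℂ n b`. [cite: Raz2010, Prop. 3.3; HeintzSchnorr1980, Basic Theorem] -/
theorem exists_lowDegree_windowEquation (b : ℕ) : ∃ n₀ : ℕ, ∀ n ≥ n₀,
    ∃ E : MvPolynomial (GKSS2017.homMonomials n (10 * b + 11)) ℂ, E ≠ 0 ∧
      E.totalDegree ≤
        3 * ((4 * (10 * b + 11 + 2) ^ 2 * (10 * b + 11 + 1) ^ 2 + (10 * b + 11) + 2) * n ^ (b + 1)) ^ 5 + 1 ∧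
      ∀ f ∈ SmallCircuits ℂ n (b), eval (coeffVector (GKSS2017.homMonomials n (10 * b + 11)) f) E = 0 := by
  refine ⟨(10 * b + 11).factorial *
        ((3 * (4 * (10 * b + 11 + 2) ^ 2 * (10 * b + 11 + 1) ^ 2 + (10 * b + 11) + 2) ^ 5 + 1) *
          (2 * (10 * b + 11) *
            (3 * (4 * (10 * b + 11 + 2) ^ 2 * (10 * b + 11 + 1) ^ 2 + (10 * b + 11) + 2) ^ 5 + 1) + 2)) +
        1, fun n hn => ?_⟩
  have hn1 : 1 ≤ n := le_trans (by omega) hn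
  obtain ⟨E, hE0, hdeg, -, hvan⟩ :=
    exists_windowEquation_degree_le (n := n) (b := b) (d := 10 * b + 11) (by omega)
      (windowCoords_eventually b hn)
  exact ⟨E, hE0, hdeg.trans (Nat.succ_le_succ (card_lab_window_le hn1)), hvan⟩

end DegreeWindow

end Summit.ValiantsHypothesis.ValiantsHypothesis.Theorems.BarrierLeverDefinableEquations
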